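import Mathlib
import Summits.KontsevichZagierPeriods.Zeta5Search.BrickPropositionH
import Summits.KontsevichZagierPeriods.Zeta5Search.BrickDigitStepD
import Summits.KontsevichZagierPeriods.Zeta5Search.BrickTheoremSixS

/-!
# BrickTheoremEight — zi-p2's THEOREM 8⁺ in kernel: the Dwork-type congruence (S) `β_s(np) ≡ β_s(n) (mod p³)` for
the FULL coefficient vector of the Ball/Rivoal brick linear forms at EVERY level `L(n) ≤ A − 4`, i.e. for every
`1 ≤ n < p^{A−3}` (cell zeta5-irr)

HONEST FRAMING: systematic search; no irrationality claim unless certified. INSTRUMENT theorem of the ζ(5)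
census cell zeta5-irr (HOME `run/shared/lean/pub/zeta5-irr/`; memos `zi-p2/probes/B8/thm8/THEOREM8.md` §1
«THEOREM 8. For every n ≥ p with L(n) ≤ L₁(A,B) := min(A − 4, A − B) (A ≥ 6) and every s ∈ {0,…,A}: β_s(np) ≡ β_s(n)
(mod p³)» and `ADDENDUM-8plus.md` «(iii) THEOREM 8⁺ (A ≥ 6): β_s(np) ≡ β_s(n) (mod p³) for every s and every n ≥ p
with L(n) ≤ A − 4; with THEOREM 2 (iii): (S) for the full coefficient vector at EVERY 1 ≤ n < p^{A−3}, for EVERY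
(A,B)»; graded zi-ref R6.23 (THEOREM 8 PASS as THEOREM; 8⁺ PASS as READING-COROLLARY); here `x_s(n) = Σ_K c_{K,s}(n)`
(`BrickPartialFractions.xCoeff`), `x_0(n) = Σ_K cell^{(0)}_K(n)` (`xZero`), `β_s(n) = p^{L(n)τ_s}x_s(n)`, `τ_s =
A−1−s`, in the β-free normalised form with the nominal level `L` (`n < p^{L+1}`; THEOREM 6 = the case `L = 1`)).
WHAT THIS IS NOT: not an irrationality statement; nothing about ζ(5); no denominator saving; rung F-Z1 NOT moved. It
is the p-adic STRUCTURE (top `A − 3` p-layers) of the coefficient vectors. Filed by the engine seat zi-eng (g9); inputs: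
`BrickPropositionH.digitTheorem{,_zero}` (DIGIT THEOREM 8⁺), `BrickDigitStepD{,Zero}.digitD{,Zero}_sub_le` (LEMMA 5),
`BrickHoleCells.offDigit{,Zero}_sum_le_three` (OFF-DIGIT THEOREM), `BrickTheoremSixS.sum_filter_dvd_eq`.

## The statements (`p ≥ 5` prime, `A` even, `1 ≤ B`, `2B ≤ A`)

* `weightedSum_le`, `weightedSumZero_le`: `v(Σ_{j≤n} u_n(j)·p^{L(A−s)}c_{j,s}(n)) ≤ exp(−L)` for `L ≤ A`,
  `n < p^{L+1}` (DIGIT THEOREM 8⁺ incl. the trivial level `0`).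
* `sum_digitD_le_level`, `sum_digitDZero_le_level` (COROLLARY 5 + DIGIT THEOREM): `v(Σ_{j≤n} D_j^{(s),L}) ≤ exp(−3)`
  for `L ≤ A`, `n < p^{L+1}`.
* **`theoremEight_S`**, **`theoremEight_Z`**, **`theoremEight`**: for `L + 4 ≤ A`, `n < p^{L+1}`, `s + 1 ≤ A`:
  `v(p^{(L+1)τ_s}·x_s(np) − p^{Lτ_s}·x_s(n)) ≤ exp(−3)` and the same for `x_0` with `τ_0 = A − 1`.
-/

namespace Summit.KontsevichZagierPeriods.Zeta5Search.BrickTheoremEight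

open Finset Nat WithZero
open Summit.KontsevichZagierPeriods.Zeta5Search.BrickLaurent (cell phiCoeff)
open Summit.KontsevichZagierPeriods.Zeta5Search.BrickPartialFractions (cellZero xCoeff xZero)
open Summit.KontsevichZagierPeriods.Zeta5Search.BrickTopKummer (cell_one_valuation_abs)
open Summit.KontsevichZagierPeriods.Zeta5Search.BrickHoleCells (pow_mul_cellZero_valuation offDigit_sum_le_three
  offDigitZero_sum_le_three)
open Summit.KontsevichZagierPeriods.Zeta5Search.BrickDigitStepD (digitD digitD_sub_le)
open Summit.KontsevichZagierPeriods.Zeta5Search.BrickDigitStepDZero (digitDZero digitDZero_sub_le)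
open Summit.KontsevichZagierPeriods.Zeta5Search.BrickTheoremSixS (sum_filter_dvd_eq)
open Summit.KontsevichZagierPeriods.Zeta5Search.BrickWeightLocality (phiWeight padicValuation_phiWeight_le)
open Summit.KontsevichZagierPeriods.Zeta5Search.BrickPropositionH (digitTheorem digitTheorem_zero)

noncomputable section

variable {p : ℕ} [Fact p.Prime]

section digit

variable (h3 : 3 < p) {A B : ℕ} (hA : Even A) (hB : 1 ≤ B) (hAB : 2 * B ≤ A)
include h3 hA hB hAB

/-- **DIGIT THEOREM 8⁺ at the nominal level `L ≤ A`** (`n < p^{L+1}`; level `0` is plain integrality):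
`v(Σ_{j≤n} u_n(j)·p^{L(A−s)}c_{j,s}(n)) ≤ exp(−L)`. -/
theorem weightedSum_le {L n : ℕ} (hLA : L ≤ A) (hn : n < p ^ (L + 1)) (s : ℕ) :
    Rat.padicValuation p (∑ j ∈ range (n + 1),
      phiWeight A B p n j * ((p : ℚ) ^ (L * (A - s)) * cell A B 1 n j s)) ≤ exp (-(L : ℤ)) := by
  have hp2 : p ≠ 2 := by omega
  rcases L with _ | L
  · simp only [Nat.cast_zero, neg_zero, exp_zero, zero_mul, pow_zero, one_mul]
    refine Valuation.map_sum_le _ fun j hj => ?_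
    have hj' : j ≤ n := by have := mem_range.1 hj; omega
    rw [map_mul]
    refine mul_le_one' (padicValuation_phiWeight_le h3 hAB n j) ?_
    have h := cell_one_valuation_abs hp2 hAB (L := 0) hn hj' s
    rwa [Nat.cast_zero, zero_mul, exp_zero] at h
  · exact_mod_cast digitTheorem h3 hA hB hAB (by omega) hn s

/-- The harmonic-cell companion: `v(Σ_{j≤n} u_n(j)·p^{LA}cell^{(0)}_j(n)) ≤ exp(−L)` (`L ≤ A`, `n < p^{L+1}`). -/
theorem weightedSumZero_le {L n : ℕ} (hLA : L ≤ A) (hn : n < p ^ (L + 1)) :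
    Rat.padicValuation p (∑ j ∈ range (n + 1),
      phiWeight A B p n j * ((p : ℚ) ^ (L * A) * cellZero A B 1 n j)) ≤ exp (-(L : ℤ)) := by
  have hp2 : p ≠ 2 := by omega
  rcases L with _ | L
  · simp only [Nat.cast_zero, neg_zero, exp_zero, zero_mul]
    refine Valuation.map_sum_le _ fun j hj => ?_
    have hj' : j ≤ n := by have := mem_range.1 hj; omega
    rw [map_mul]
    refine mul_le_one' (padicValuation_phiWeight_le h3 hAB n j) ?_
    refine (pow_mul_cellZero_valuation hp2 hAB (L := 0) hn hj' 0).trans (exp_le_exp.2 ?_)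
    simp only [Nat.cast_zero, zero_mul, Nat.cast_mul]
    nlinarith [Int.natCast_nonneg A, Int.natCast_nonneg (padicValNat p (n.choose j))]
  · exact_mod_cast digitTheorem_zero h3 hA hB hAB (by omega) hn

/-- **COROLLARY 5 + DIGIT THEOREM, cells `s ≥ 1`**: `Σ_{j≤n} D_j^{(s),L} ≡ 0 (mod p³)` for `L ≤ A`, `n < p^{L+1}`,
`s + 1 ≤ A` (LEMMA 5: `D_j ≡ p^{3−L}u(j)r_j^{(s)}`; then the digit theorem). -/
theorem sum_digitD_le_level {L n s : ℕ} (hLA : L ≤ A) (hn : n < p ^ (L + 1)) (hs : s + 1 ≤ A) :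
    Rat.padicValuation p (∑ j ∈ range (n + 1), digitD A B p L n j s) ≤ exp (-3) := by
  have hp : p.Prime := Fact.out
  have hpQ : (p : ℚ) ≠ 0 := by exact_mod_cast hp.ne_zero
  -- LEMMA 5 termwise, and the main terms collected
  have hsplit : ∑ j ∈ range (n + 1), digitD A B p L n j s =
      ∑ j ∈ range (n + 1), (digitD A B p L n j s -
        (p : ℚ) ^ (L * (A - 1 - s)) * (phiCoeff A B p n j 0 - 1) * cell A B 1 n j s) +
      (p : ℚ) ^ 3 / (p : ℚ) ^ L * ∑ j ∈ range (n + 1),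
        phiWeight A B p n j * ((p : ℚ) ^ (L * (A - s)) * cell A B 1 n j s) := by
    rw [Finset.mul_sum, ← Finset.sum_add_distrib]
    refine Finset.sum_congr rfl fun j _ => ?_
    rw [phiWeight, show L * (A - s) = L * (A - 1 - s) + L by rw [← Nat.mul_succ]; congr 1; omega, pow_add]
    field_simp
    ring
  rw [hsplit]
  refine Valuation.map_add_le _ (Valuation.map_sum_le _ fun j hj => ?_) ?_
  · exact digitD_sub_le h3 hAB hn (by have := mem_range.1 hj; omega) hs
  · rw [map_mul, map_div₀, map_pow, map_pow, Rat.padicValuation_self, ← exp_nsmul, ← exp_nsmul, ← exp_sub]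
    calc _ ≤ exp ((3 : ℕ) • (-1 : ℤ) - (L : ℕ) • (-1 : ℤ)) * exp (-(L : ℤ)) :=
          mul_le_mul' le_rfl (weightedSum_le h3 hA hB hAB hLA hn s)
      _ = exp (-3) := by rw [← exp_add]; congr 1; simp only [nsmul_eq_mul]; ring

/-- **COROLLARY 5 + DIGIT THEOREM, harmonic cell**: `Σ_{j≤n} D_j^{(0),L} ≡ 0 (mod p³)` for `L ≤ A`, `n < p^{L+1}`,
`1 ≤ A`. -/
theorem sum_digitDZero_le_level {L n : ℕ} (hLA : L ≤ A) (hA1 : 1 ≤ A) (hn : n < p ^ (L + 1)) :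
    Rat.padicValuation p (∑ j ∈ range (n + 1), digitDZero A B p L n j) ≤ exp (-3) := by
  have hp : p.Prime := Fact.out
  have hpQ : (p : ℚ) ≠ 0 := by exact_mod_cast hp.ne_zero
  have hsplit : ∑ j ∈ range (n + 1), digitDZero A B p L n j =
      ∑ j ∈ range (n + 1), (digitDZero A B p L n j -
        (p : ℚ) ^ (L * (A - 1)) * (phiCoeff A B p n j 0 - 1) * cellZero A B 1 n j) +
      (p : ℚ) ^ 3 / (p : ℚ) ^ L * ∑ j ∈ range (n + 1),
        phiWeight A B p n j * ((p : ℚ) ^ (L * A) * cellZero A B 1 n j) := by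
    rw [Finset.mul_sum, ← Finset.sum_add_distrib]
    refine Finset.sum_congr rfl fun j _ => ?_
    rw [phiWeight, show L * A = L * (A - 1) + L by rw [← Nat.mul_succ]; congr 1; omega, pow_add]
    field_simp
    ring
  rw [hsplit]
  refine Valuation.map_add_le _ (Valuation.map_sum_le _ fun j hj => ?_) ?_
  · exact digitDZero_sub_le h3 hAB hA1 hn (by have := mem_range.1 hj; omega)
  · rw [map_mul, map_div₀, map_pow, map_pow, Rat.padicValuation_self, ← exp_nsmul, ← exp_nsmul, ← exp_sub]
    calc _ ≤ exp ((3 : ℕ) • (-1 : ℤ) - (L : ℕ) • (-1 : ℤ)) * exp (-(L : ℤ)) :=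
          mul_le_mul' le_rfl (weightedSumZero_le h3 hA hB hAB hLA hn)
      _ = exp (-3) := by rw [← exp_add]; congr 1; simp only [nsmul_eq_mul]; ring

/-! ## THEOREM 8⁺ -/

/-- **THEOREM 8⁺ (S), cells `s ≥ 1`** (zi-p2; `p ≥ 5`, `A` even, `1 ≤ B`, `2B ≤ A`): for every level `L` with
`L + 4 ≤ A`, every `n < p^{L+1}` and `s + 1 ≤ A`:
`v_p(p^{(L+1)τ_s}·x_s(np) − p^{Lτ_s}·x_s(n)) ≥ 3`, `τ_s = A − 1 − s` — the normalised Dwork congruence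
`β_s(np) ≡ β_s(n) (mod p³)` for the Ball/Rivoal brick coefficient `x_s` on the first `A − 3` `p`-adic levels
(THEOREM 6 = the case `L = 1`). -/
theorem theoremEight_S {L n s : ℕ} (hLA : L + 4 ≤ A) (hn : n < p ^ (L + 1)) (hs : s + 1 ≤ A) :
    Rat.padicValuation p ((p : ℚ) ^ ((L + 1) * (A - 1 - s)) * xCoeff A B 1 (n * p) s -
      (p : ℚ) ^ (L * (A - 1 - s)) * xCoeff A B 1 n s) ≤ exp (-3) := by
  have hp : p.Prime := Fact.out
  have hp2 : p ≠ 2 := by omega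
  set τ := A - 1 - s with hτ
  -- split the level-`np` sum into digits and off-digits
  have hsplit : (p : ℚ) ^ ((L + 1) * τ) * xCoeff A B 1 (n * p) s - (p : ℚ) ^ (L * τ) * xCoeff A B 1 n s =
      ∑ j ∈ range (n + 1), digitD A B p L n j s +
        ∑ K ∈ (range (n * p + 1)).filter (fun K => ¬ p ∣ K), (p : ℚ) ^ ((L + 1) * τ) * cell A B 1 (n * p) K s := by
    unfold xCoeff
    rw [Finset.mul_sum, Finset.mul_sum, ← sum_filter_add_sum_filter_not (range (n * p + 1)) (fun K => p ∣ K),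
      sum_filter_dvd_eq, add_sub_right_comm, ← Finset.sum_sub_distrib]
    congr 1
    refine Finset.sum_congr rfl fun j _ => ?_
    rw [digitD, hτ, add_mul, one_mul, pow_add]
    ring
  rw [hsplit]
  exact (Valuation.map_add _ _ _).trans
    (max_le (sum_digitD_le_level h3 hA hB hAB (by omega) hn hs) (offDigit_sum_le_three hp2 hAB hn hLA hs))

/-- **THEOREM 8⁺ (S), harmonic cell `s = 0`**: `v_p(p^{(L+1)(A−1)}·x_0(np) − p^{L(A−1)}·x_0(n)) ≥ 3` for
`L + 4 ≤ A`, `n < p^{L+1}`. -/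
theorem theoremEight_Z {L n : ℕ} (hLA : L + 4 ≤ A) (hn : n < p ^ (L + 1)) :
    Rat.padicValuation p ((p : ℚ) ^ ((L + 1) * (A - 1)) * xZero A B 1 (n * p) -
      (p : ℚ) ^ (L * (A - 1)) * xZero A B 1 n) ≤ exp (-3) := by
  have hp : p.Prime := Fact.out
  have hp2 : p ≠ 2 := by omega
  set τ := A - 1 with hτ
  have hsplit : (p : ℚ) ^ ((L + 1) * τ) * xZero A B 1 (n * p) - (p : ℚ) ^ (L * τ) * xZero A B 1 n =
      ∑ j ∈ range (n + 1), digitDZero A B p L n j +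
        ∑ K ∈ (range (n * p + 1)).filter (fun K => ¬ p ∣ K), (p : ℚ) ^ ((L + 1) * τ) * cellZero A B 1 (n * p) K := by
    unfold xZero
    rw [Finset.mul_sum, Finset.mul_sum, ← sum_filter_add_sum_filter_not (range (n * p + 1)) (fun K => p ∣ K),
      sum_filter_dvd_eq, add_sub_right_comm, ← Finset.sum_sub_distrib]
    congr 1
    refine Finset.sum_congr rfl fun j _ => ?_
    rw [digitDZero, hτ, add_mul, one_mul, pow_add]
    ring
  rw [hsplit]
  exact (Valuation.map_add _ _ _).trans
    (max_le (sum_digitDZero_le_level h3 hA hB hAB (by omega) (by omega) hn)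
      (offDigitZero_sum_le_three hp2 hAB hn hLA))

/-- **THEOREM 8⁺ = the whole display (S) at every level `L ≤ A − 4`**: for `p ≥ 5`, `A` even, `1 ≤ B`, `2B ≤ A`,
`L + 4 ≤ A` and every `n < p^{L+1}`: the harmonic cell and every cell `s + 1 ≤ A` satisfy
`β_s(np) ≡ β_s(n) (mod p³)` in normalised form. With `L` ranging over `0, …, A − 4` this covers every
`1 ≤ n < p^{A−3}` (zi-p2 ADDENDUM THEOREM 8⁺ (iii)). -/
theorem theoremEight {L n : ℕ} (hLA : L + 4 ≤ A) (hn : n < p ^ (L + 1)) :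
    Rat.padicValuation p ((p : ℚ) ^ ((L + 1) * (A - 1)) * xZero A B 1 (n * p) -
        (p : ℚ) ^ (L * (A - 1)) * xZero A B 1 n) ≤ exp (-3) ∧
      ∀ s, s + 1 ≤ A → Rat.padicValuation p ((p : ℚ) ^ ((L + 1) * (A - 1 - s)) * xCoeff A B 1 (n * p) s -
        (p : ℚ) ^ (L * (A - 1 - s)) * xCoeff A B 1 n s) ≤ exp (-3) :=
  ⟨theoremEight_Z h3 hA hB hAB hLA hn, fun _ hs => theoremEight_S h3 hA hB hAB hLA hn hs⟩

end digit

end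

end Summit.KontsevichZagierPeriods.Zeta5Search.BrickTheoremEight
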